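import Mathlib
import Summits.NavierStokesRegularity.NavierStokesRegularity.Theses.CloudStretchingBudget
import Literature.Analysis.FluidPDE.SereginZajaczkowski2007L42Vorticity
import HarnessLib

/-!
# Route CloudStretchingBudget — support item `GronwallClock` PROVED
  (stmt-NavierStokesRegularity-17842; pure real analysis)

**Theorem (`cloudStretchingBudget_gronwallClock_proof`).** If `M` is continuous on `[t₁, T)` and
`M(t₃) ≤ M(t₂) + (1 − δ) ∫_{t₂}^{t₃} M(s)/(T − s) ds` for all `t₁ ≤ t₂ ≤ t₃ < T`, with
`δ ∈ (0, 1]`, then `(T − t) M(t)` is eventually (as `t ↑ T`) below every `m > 0`.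

Proof. With `M₀ = max(M(t₁), 0)` and the kernel `a(s) = (1 − δ)/(T − s) ≥ 0`, the hypothesis at
`t₂ = t₁` gives `M⁺(t) ≤ M₀ + ∫_{t₁}^{t} a M⁺` on `[t₁, T)` (`a ≥ 0`, `M ≤ M⁺`), so Grönwall's lemma
with the `L¹` kernel `a` on every `[t₁, t]` (the tree's `lintegral_gronwall_le_of_Icc`,
Robinson–Rodrigo–Sadowski 2016, Lemma A.25) yields
`M(t) ≤ M₀ exp(∫_{t₁}^{t} a) = M₀ ((T − t₁)/(T − t))^{1−δ}`, i.e.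
`(T − t) M(t) ≤ M₀ (T − t₁)^{1−δ} (T − t)^{δ} → 0`.

HONEST FRAMING: an elementary lemma (no Navier–Stokes content); nothing here bears on the regularity
question. Lands `--workitem stmt-NavierStokesRegularity-17842` (typer seat g19 of cell pub-ns-dss,
idle-row item).
-/

noncomputable section

set_option linter.dupNamespace false

namespace Summit.NavierStokesRegularity.NavierStokesRegularity.Theorems

open MeasureTheory Set Filter Topology intervalIntegral
open scoped ENNReal NNReal Topology
open Literature.Analysis.FluidPDE.SereginZajaczkowski2007

namespace CloudStretching

/-- `∫_{t₁}^{t} (1 − δ)/(T − s) ds = (1 − δ) log((T − t₁)/(T − t))` for `t₁ ≤ t < T`. [folklore] -/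
theorem integral_kernel_eq {T t₁ t δ : ℝ} (h₁ : t₁ ≤ t) (ht : t < T) :
    ∫ s in t₁..t, (1 - δ) / (T - s) = (1 - δ) * Real.log ((T - t₁) / (T - t)) := by
  have h0 : (0 : ℝ) ∉ uIcc (T - t) (T - t₁) := by
    rw [uIcc_of_le (by linarith)]
    intro h; exact absurd h.1 (not_le.2 (by linarith))
  have e : ∫ s in t₁..t, (1 - δ) / (T - s) = (1 - δ) * ∫ s in t₁..t, (T - s)⁻¹ := by
    rw [← intervalIntegral.integral_const_mul]
    refine intervalIntegral.integral_congr fun s _ => ?_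
    simp only [div_eq_mul_inv]
  rw [e, intervalIntegral.integral_comp_sub_left (fun x => x⁻¹) T, integral_inv h0]

/-- **The Grönwall bound.** Under the hypotheses of `GronwallClock`,
`M(t) ≤ max(M(t₁), 0) · ((T − t₁)/(T − t))^{1−δ}` for `t ∈ [t₁, T)`. [folklore] -/
theorem le_mul_rpow_of_clockIneq {T t₁ δ : ℝ} {M : ℝ → ℝ} (ht₁ : t₁ < T) (hδ1 : δ ≤ 1)
    (hcont : ContinuousOn M (Ico t₁ T))
    (hineq : ∀ t₂ t₃ : ℝ, t₁ ≤ t₂ → t₂ ≤ t₃ → t₃ < T →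
      M t₃ ≤ M t₂ + (1 - δ) * ∫ s in t₂..t₃, M s / (T - s))
    {t : ℝ} (ht : t ∈ Ico t₁ T) :
    M t ≤ max (M t₁) 0 * ((T - t₁) / (T - t)) ^ (1 - δ) := by
  set M₀ : ℝ := max (M t₁) 0 with hM₀
  have hM₀0 : 0 ≤ M₀ := le_max_right _ _
  have hδ' : 0 ≤ 1 - δ := sub_nonneg.2 hδ1
  -- work on the compact interval `[t₁, t]`
  have hsub : Icc t₁ t ⊆ Ico t₁ T := fun s hs => ⟨hs.1, hs.2.trans_lt ht.2⟩
  have hcontI : ContinuousOn M (Icc t₁ t) := hcont.mono hsub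
  set Mp : ℝ → ℝ := fun s => max (M s) 0 with hMp
  have hMp0 : ∀ s, 0 ≤ Mp s := fun s => le_max_right _ _
  have hcontMp : ContinuousOn Mp (Icc t₁ t) := by
    simpa only [hMp] using ContinuousOn.sup hcontI continuousOn_const
  set a : ℝ → ℝ := fun s => (1 - δ) / (T - s) with ha
  have ha0 : ∀ s, s < T → 0 ≤ a s := fun s hs => div_nonneg hδ' (sub_pos.2 hs).le
  have hconta : ContinuousOn a (Icc t₁ t) :=
    continuousOn_const.div (continuousOn_const.sub continuousOn_id)
      fun s hs => (sub_pos.2 (hs.2.trans_lt ht.2)).ne'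
  -- bound for `M⁺` on `[t₁, t]`
  obtain ⟨K, hK⟩ := isCompact_Icc.exists_bound_of_continuousOn hcontMp
  have hKle : ∀ s ∈ Icc t₁ t, Mp s ≤ K := fun s hs =>
    (le_abs_self _).trans ((Real.norm_eq_abs _).symm.le.trans (hK s hs))
  -- the kernel bound on `[t₁, t]`
  have haK : ∀ s ∈ Icc t₁ t, a s ≤ (1 - δ) / (T - t) := fun s hs =>
    div_le_div_of_nonneg_left hδ' (sub_pos.2 ht.2) (by linarith [hs.2])
  -- the real integral inequality for `M⁺` on `[t₁, t]`
  have hintI : ∀ s ∈ Icc t₁ t, IntervalIntegrable (fun r => a r * Mp r) volume t₁ s := by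
    intro s hs
    exact ((hconta.mul hcontMp).mono (Icc_subset_Icc le_rfl hs.2)).intervalIntegrable_of_Icc hs.1
  have hreal : ∀ s ∈ Icc t₁ t, Mp s ≤ M₀ + ∫ r in Ioo t₁ s, a r * Mp r := by
    intro s hs
    have h := hineq t₁ s le_rfl hs.1 (hs.2.trans_lt ht.2)
    have hI1 : IntervalIntegrable (fun r => M r / (T - r)) volume t₁ s :=
      ((hcontI.div (continuousOn_const.sub continuousOn_id) fun r hr =>
        (sub_pos.2 (hr.2.trans_lt ht.2)).ne').mono (Icc_subset_Icc le_rfl hs.2)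
        |>.intervalIntegrable_of_Icc hs.1)
    have hmono : (1 - δ) * ∫ r in t₁..s, M r / (T - r) ≤ ∫ r in t₁..s, a r * Mp r := by
      rw [← intervalIntegral.integral_const_mul]
      refine intervalIntegral.integral_mono_on hs.1 (hI1.const_mul _) (hintI s hs) fun r hr => ?_
      have hTr : 0 < T - r := sub_pos.2 ((hr.2.trans hs.2).trans_lt ht.2)
      simp only [ha, hMp]
      rw [div_mul_eq_mul_div, mul_div_assoc]
      exact mul_le_mul_of_nonneg_left (div_le_div_of_nonneg_right (le_max_left _ _) hTr.le) hδ'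
    have hpos : 0 ≤ M₀ + ∫ r in Ioo t₁ s, a r * Mp r := by
      refine add_nonneg hM₀0 (setIntegral_nonneg measurableSet_Ioo fun r hr => ?_)
      exact mul_nonneg (ha0 r ((hr.2.trans_le hs.2).trans ht.2)) (hMp0 r)
    have e : ∫ r in t₁..s, a r * Mp r = ∫ r in Ioo t₁ s, a r * Mp r := by
      rw [intervalIntegral.integral_of_le hs.1, integral_Ioc_eq_integral_Ioo]
    rw [hMp, max_le_iff]
    refine ⟨?_, hpos⟩
    calc M s ≤ M t₁ + (1 - δ) * ∫ r in t₁..s, M r / (T - r) := h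
      _ ≤ M₀ + ∫ r in Ioo t₁ s, a r * Mp r := by rw [← e]; exact add_le_add (le_max_left _ _) hmono
  -- Grönwall in `ℝ≥0∞`
  have hφ : ∀ s ∈ Icc t₁ t, ENNReal.ofReal (Mp s) ≤ ENNReal.ofReal M₀ +
      ∫⁻ r in Ioo t₁ s, ENNReal.ofReal (a r) * ENNReal.ofReal (Mp r) := by
    intro s hs
    have hsub' : Ioo t₁ s ⊆ Icc t₁ t := fun r hr => ⟨hr.1.le, hr.2.le.trans hs.2⟩
    have hint : IntegrableOn (fun r => a r * Mp r) (Ioo t₁ s) :=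
      ((hconta.mul hcontMp).mono (Icc_subset_Icc le_rfl hs.2)).integrableOn_compact isCompact_Icc
        |>.mono_set (Ioo_subset_Icc_self)
    have hnn : 0 ≤ᵐ[volume.restrict (Ioo t₁ s)] fun r => a r * Mp r :=
      (ae_restrict_iff' measurableSet_Ioo).2 (Eventually.of_forall fun r hr =>
        mul_nonneg (ha0 r ((hr.2.trans_le hs.2).trans ht.2)) (hMp0 r))
    calc ENNReal.ofReal (Mp s) ≤ ENNReal.ofReal (M₀ + ∫ r in Ioo t₁ s, a r * Mp r) :=
          ENNReal.ofReal_le_ofReal (hreal s hs)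
      _ ≤ ENNReal.ofReal M₀ + ENNReal.ofReal (∫ r in Ioo t₁ s, a r * Mp r) := ENNReal.ofReal_add_le
      _ = ENNReal.ofReal M₀ + ∫⁻ r in Ioo t₁ s, ENNReal.ofReal (a r * Mp r) := by
          rw [ofReal_integral_eq_lintegral_ofReal hint hnn]
      _ = ENNReal.ofReal M₀ + ∫⁻ r in Ioo t₁ s, ENNReal.ofReal (a r) * ENNReal.ofReal (Mp r) := by
          congr 1
          refine setLIntegral_congr_fun measurableSet_Ioo fun r hr => ?_
          rw [ENNReal.ofReal_mul (ha0 r ((hr.2.trans_le hs.2).trans ht.2))]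
  have ha_fin : ∫⁻ r in Ioo t₁ t, ENNReal.ofReal (a r) ≠ ⊤ := by
    refine ne_top_of_le_ne_top (b := ∫⁻ _ in Ioo t₁ t, ENNReal.ofReal ((1 - δ) / (T - t))) ?_ ?_
    · rw [setLIntegral_const]
      exact ENNReal.mul_ne_top ENNReal.ofReal_ne_top (measure_Ioo_lt_top.ne)
    · exact setLIntegral_mono measurable_const fun r hr =>
        ENNReal.ofReal_le_ofReal (haK r ⟨hr.1.le, hr.2.le⟩)
  have hG := lintegral_gronwall_le_of_Icc (T₀ := t₁) (T₁ := t) (φ := fun s => ENNReal.ofReal (Mp s))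
    (a := fun s => ENNReal.ofReal (a s)) (B := ENNReal.ofReal M₀) (M := ENNReal.ofReal K)
    ENNReal.ofReal_ne_top ENNReal.ofReal_ne_top
    (fun s hs => ENNReal.ofReal_le_ofReal (hKle s hs)) ha_fin hφ t ⟨ht.1, le_rfl⟩
  -- evaluate the kernel integral
  have hat : IntegrableOn a (Ioo t₁ t) :=
    (hconta.integrableOn_compact isCompact_Icc).mono_set Ioo_subset_Icc_self
  have hann : 0 ≤ᵐ[volume.restrict (Ioo t₁ t)] a :=
    (ae_restrict_iff' measurableSet_Ioo).2 (Eventually.of_forall fun r hr => ha0 r (hr.2.trans ht.2))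
  have hexp : (∫⁻ r in Ioo t₁ t, ENNReal.ofReal (a r)).toReal =
      (1 - δ) * Real.log ((T - t₁) / (T - t)) := by
    rw [← ofReal_integral_eq_lintegral_ofReal hat hann, ENNReal.toReal_ofReal
      (setIntegral_nonneg measurableSet_Ioo fun r hr => ha0 r (hr.2.trans ht.2)),
      ← integral_Ioc_eq_integral_Ioo, ← intervalIntegral.integral_of_le ht.1]
    exact integral_kernel_eq ht.1 ht.2
  have hratio : 0 < (T - t₁) / (T - t) := div_pos (sub_pos.2 ht₁) (sub_pos.2 ht.2)
  have hpow : Real.exp ((1 - δ) * Real.log ((T - t₁) / (T - t))) = ((T - t₁) / (T - t)) ^ (1 - δ) := by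
    rw [Real.rpow_def_of_pos hratio, mul_comm]
  rw [hexp, hpow, ← ENNReal.ofReal_mul hM₀0] at hG
  have hfin := (ENNReal.ofReal_le_ofReal_iff (mul_nonneg hM₀0 (Real.rpow_nonneg hratio.le _))).1 hG
  exact (le_max_left _ _).trans hfin

end CloudStretching

open CloudStretching

/-- **`GronwallClock` (item stmt-NavierStokesRegularity-17842, route CloudStretchingBudget).** If `M`
is continuous on `[t₁, T)` and `M(t₃) ≤ M(t₂) + (1 − δ)∫_{t₂}^{t₃} M(s)/(T − s) ds` for all
`t₁ ≤ t₂ ≤ t₃ < T`, `δ ∈ (0, 1]`, then `(T − t) M(t)` is eventually below every `m > 0` as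
`t ↑ T` (Grönwall: `(T − t)M(t) ≤ M₀ (T − t₁)^{1−δ}(T − t)^{δ} → 0`). [folklore] -/
theorem cloudStretchingBudget_gronwallClock_proof : Theses.CloudStretchingBudget.GronwallClock := by
  intro T t₁ δ M ht₁ hδ0 hδ1 hcont hineq m hm
  set M₀ : ℝ := max (M t₁) 0 with hM₀
  have hM₀0 : 0 ≤ M₀ := le_max_right _ _
  set K : ℝ := M₀ * (T - t₁) ^ (1 - δ) with hK
  have hK0 : 0 ≤ K := mul_nonneg hM₀0 (Real.rpow_nonneg (sub_pos.2 ht₁).le _)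
  -- `K (T − t)^δ → 0` as `t → T`
  have htend : Tendsto (fun t => K * (T - t) ^ δ) (𝓝[<] T) (𝓝 0) := by
    have hc : Continuous fun t : ℝ => K * (T - t) ^ δ :=
      continuous_const.mul ((continuous_const.sub continuous_id).rpow_const fun _ => Or.inr hδ0.le)
    have h := hc.tendsto T
    rw [sub_self, Real.zero_rpow hδ0.ne', mul_zero] at h
    exact h.mono_left nhdsWithin_le_nhds
  have hev : ∀ᶠ t in 𝓝[<] T, K * (T - t) ^ δ < m := (tendsto_order.1 htend).2 m hm
  filter_upwards [hev, Ico_mem_nhdsLT ht₁] with t hlt ht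
  have hTt : 0 < T - t := sub_pos.2 ht.2
  have hbound := le_mul_rpow_of_clockIneq ht₁ hδ1 hcont hineq ht
  have halg : (T - t) * (M₀ * ((T - t₁) / (T - t)) ^ (1 - δ)) = K * (T - t) ^ δ := by
    rw [hK, Real.div_rpow (sub_pos.2 ht₁).le hTt.le, Real.rpow_sub hTt, Real.rpow_one]
    field_simp
  calc (T - t) * M t ≤ (T - t) * (M₀ * ((T - t₁) / (T - t)) ^ (1 - δ)) :=
        mul_le_mul_of_nonneg_left hbound hTt.le
    _ = K * (T - t) ^ δ := halg
    _ < m := hlt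

end Summit.NavierStokesRegularity.NavierStokesRegularity.Theorems

end
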